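import Mathlib.Analysis.InnerProductSpace.Basic
import HarnessLib

/-!
# Route `UnitScaleTilt`, crux «MinimiserStabilityRegPr» (stmt-QuantumFields-19200, stub EX), EX row `hGF`[Lift] (curved member), the LOD ∕ Combes–Thomas line, ★p1 g24's
# `LOCATE-L6-ASSEMBLY` §1 Step I.2 pen (L5″) — **ENGINE (operator form): THE CUT-OFF RESOLVENT COMPARISON** — for two coercive operators `A_U, A_V` with two-sided inverses
# `G_U, G_V` and ANY «cutoff» operator `X`:  `G_U∘X − X∘G_V = G_U∘(X∘A_V − A_U∘X)∘G_V`, hence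
# `‖(G_U X − X G_V)f‖ ≤ m_U⁻¹·(c₁·m_V^{−1∕2} + c₀·m_V⁻¹)·‖f‖` as soon as the TWISTED difference `X A_V − A_U X = −(X(A_U − A_V) + [A_U, X])` is first-order small:
# `‖(X A_V − A_U X)w‖ ≤ c₁‖D̃_V w‖ + c₀‖w‖` (ym3-torus-px5 g11, `LOCATE-L5pp-localisation-px5g11.md`; `X = id` is ★p1 g24's ✓p748261 `norm_inv_sub_inv_mulVec_le` in operator letters).

Cell `ym3-torus` (HUMAN RULING D-0037: YM₃ on T³ is ladder rung R3 — NOT d = 4, NOT infinite volume, NOT a mass gap, NOT Clay).  Width seat `ym3-torus-px5` (gen 11; WIDTH COPY of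
ym3-torus-p1).  THEOREMS ONLY (0 `def`, 0 `sorry`); Mathlib only; `--supports stmt-QuantumFields-19200 --as helper`, count-neutral.  HONEST LABEL (№33 (6)∕№35): curved γ-row supplier line
(LOD localisation); ENGINE lemma; nothing of (L5″), (L6), (3.49), `h349`, `hGF`, EX ∕ 19200 is proved.

THE POINT (the located design point of (L5″)).  The local comparison of `P_U = B M⁻¹ B†` with its flat model in the cube gauge cannot go through a GLOBAL operator-norm row
`‖(G_U − G_V)f‖ ≤ δ_G‖f‖`: at the member `A_U − A_V ∋ D_U − D_V = η⁻¹(Ad U − Ad V)` is `O(ε₀R″)` only on the cube `□̃_j` where `V` is the axial pure gauge of `U`, and `O(η⁻¹)`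
elsewhere (no global small gauge: volume and torons).  With a cutoff `X` (multiplication by a block-constant `χ`, `χ = 1` near `□_j`, `supp χ ⊆ □̃_j`) the twisted difference
`X A_V − A_U X = −(χ·(A_U − A_V) + [A_U, χ])` sees `U − V` ONLY on `supp χ` and the commutator `[A_U, χ] = [Δ_U, χ]` (the mass term commutes with block constants, ✓p747466) is
first order with coefficients `|∇χ| ≤ (R″ − R′)⁻¹` (✓`Prop7Lane2CutoffCommutators`) — so `c₁, c₀ = O(ε₀R″ + (R″−R′)⁻¹)`, free of `η`, `K`, volume.

WHAT IS PROVED (sorry-free, no definition; ns `…Theorems.Prop7CutoffResolventComparison`; `E, F, F'` complex inner-product spaces; all maps `ℂ`-linear).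
* §1 `norm_le_inv_coercive` (`m‖u‖² ≤ re⟪u, Au⟫`, `A(Gy) = y` ⟹ `‖Gy‖ ≤ m⁻¹‖y‖`), `norm_D_inv_le` (`+ ‖Dw‖² ≤ re⟪w, Aw⟫` ⟹ `‖D(Gy)‖ ≤ √(m⁻¹)·‖y‖`).
* §2 ★`inv_comp_sub_comp_inv_eq` — `G_U(Xf) − X(G_Vf) = G_U((X∘A_V − A_U∘X)(G_Vf))` (`G_U∘A_U = id`, `A_V∘G_V = id`).
* §3 ★★★`norm_inv_cutoff_comm_le` — the displayed bound; ★★`norm_D_inv_cutoff_comm_le` — its energy edition `‖D̃_U((G_UX − XG_V)f)‖ ≤ m_U^{−1∕2}·(c₁m_V^{−1∕2} + c₀m_V⁻¹)·‖f‖` (the `𝔥`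
  currency of Step I.2).
* §4 ★★★`norm_inv_cutoff_comm_le_of_form` — THE FORM EDITION second-order differences need (`Δ_U − Δ_V = D_U*∘(bounded) + (bounded)∘D_V` is small only in pairings): the twisted
  difference small as a FORM `|re⟪z,(XA_V − A_UX)w⟫| ≤ (c₁‖D̃_Vw‖ + c₀‖w‖)(‖D̃_Uz‖ + ‖z‖)` ⟹ `‖D̃_U(error)‖ ≤ (1 + √(m_U⁻¹))N_f`, `‖error‖ ≤ √(m_U⁻¹)(1 + √(m_U⁻¹))N_f`,
  `N_f = (c₁√(m_V⁻¹) + c₀m_V⁻¹)‖f‖` (test `A_Ue = Y` with `e`); `sqrt_le_of_sq_le_mul` (the scalar step).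
HONEST SCOPE.  Abstract finite-free linear algebra (no dimension hypothesis); no member letter; nothing of (L5″)∕(L6), (3.49), `h349`, `hGF`, EX or the crux is proved here.

References: T. Bałaban, CMP **99** (1985) 389–434 [Balaban1985BackgroundPropagators] (Thm 3.3 p.399, (3.100)–(3.105) pp.413–414 — commutators with cut-offs in the local
comparison); CMP **96** (1984) 223–250 [Balaban1984PropagatorsII] (p.238); S. Agmon, *Lectures on exponential decay* (Princeton 1982) [Agmon1982].
-/

set_option autoImplicit false

noncomputable section

open scoped InnerProductSpace ComplexConjugate

namespace Summit.QuantumFields.YangMills.Theorems.Prop7CutoffResolventComparison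

variable {E F F' : Type*} [NormedAddCommGroup E] [InnerProductSpace ℂ E] [NormedAddCommGroup F] [InnerProductSpace ℂ F]
  [NormedAddCommGroup F'] [InnerProductSpace ℂ F']

/-! ## §1 Coercive operators: the inverse and its energy are bounded -/

/-- **`‖G y‖ ≤ m⁻¹‖y‖`** for a right inverse `G` of an `m`-coercive `A` (`m‖u‖² ≤ re⟪u, Au⟫ = re⟪u, y⟫ ≤ ‖u‖‖y‖`). [cite: Balaban1985BackgroundPropagators, Thm 3.11 p.416] -/
theorem norm_le_inv_coercive (A G : E →ₗ[ℂ] E) (hAG : ∀ y, A (G y) = y) {m : ℝ} (hm : 0 < m)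
    (hco : ∀ u : E, m * ‖u‖ ^ 2 ≤ RCLike.re ⟪u, A u⟫_ℂ) (y : E) : ‖G y‖ ≤ m⁻¹ * ‖y‖ := by
  have h1 := hco (G y)
  rw [hAG] at h1
  have hcs : RCLike.re ⟪G y, y⟫_ℂ ≤ ‖G y‖ * ‖y‖ := (RCLike.re_le_norm _).trans (norm_inner_le_norm _ _)
  rw [inv_mul_eq_div, le_div_iff₀ hm, mul_comm]
  by_cases h0 : ‖G y‖ = 0
  · rw [h0, mul_zero]; positivity
  · have hpos : 0 < ‖G y‖ := lt_of_le_of_ne (norm_nonneg _) (Ne.symm h0)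
    nlinarith

/-- **`‖D(G y)‖ ≤ √(m⁻¹)·‖y‖`** when in addition `‖Dw‖² ≤ re⟪w, Aw⟫` (the energy is dominated by the form). [cite: Balaban1985BackgroundPropagators, (3.105) p.414] -/
theorem norm_D_inv_le (A G : E →ₗ[ℂ] E) (D : E →ₗ[ℂ] F) (hAG : ∀ y, A (G y) = y) {m : ℝ} (hm : 0 < m)
    (hco : ∀ u : E, m * ‖u‖ ^ 2 ≤ RCLike.re ⟪u, A u⟫_ℂ) (henergy : ∀ w : E, ‖D w‖ ^ 2 ≤ RCLike.re ⟪w, A w⟫_ℂ) (y : E) :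
    ‖D (G y)‖ ≤ Real.sqrt m⁻¹ * ‖y‖ := by
  have hG := norm_le_inv_coercive A G hAG hm hco y
  have h1 := henergy (G y)
  rw [hAG] at h1
  have hcs : RCLike.re ⟪G y, y⟫_ℂ ≤ ‖G y‖ * ‖y‖ := (RCLike.re_le_norm _).trans (norm_inner_le_norm _ _)
  have h2 : ‖D (G y)‖ ^ 2 ≤ (Real.sqrt m⁻¹ * ‖y‖) ^ 2 := by
    rw [mul_pow, Real.sq_sqrt (inv_nonneg.mpr hm.le)]
    calc ‖D (G y)‖ ^ 2 ≤ ‖G y‖ * ‖y‖ := h1.trans hcs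
      _ ≤ m⁻¹ * ‖y‖ * ‖y‖ := mul_le_mul_of_nonneg_right hG (norm_nonneg _)
      _ = m⁻¹ * ‖y‖ ^ 2 := by ring
  exact (pow_le_pow_iff_left₀ (norm_nonneg _) (by positivity) two_ne_zero).1 h2

/-! ## §2 The cut-off resolvent identity -/

/-- ★ **THE CUT-OFF RESOLVENT IDENTITY**: `G_U(Xf) − X(G_Vf) = G_U((X∘A_V − A_U∘X)(G_Vf))` whenever `G_U∘A_U = id` and `A_V∘G_V = id`.  (`X = id`: the second resolvent identity.)
[cite: Balaban1985BackgroundPropagators, (3.100)–(3.105) pp.413–414] -/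
theorem inv_comp_sub_comp_inv_eq (AU AV GU GV X : E →ₗ[ℂ] E) (hGA : ∀ v, GU (AU v) = v) (hAG : ∀ v, AV (GV v) = v) (f : E) :
    GU (X f) - X (GV f) = GU (X (AV (GV f)) - AU (X (GV f))) := by
  rw [map_sub, hAG, hGA]

/-! ## §3 The bounds -/

/-- ★★★ **THE CUT-OFF RESOLVENT COMPARISON**: `A_U` `m_U`-coercive with two-sided inverse `G_U`, `A_V` `m_V`-coercive with right inverse `G_V` and energy `‖D̃w‖² ≤ re⟪w, A_Vw⟫`, and the
TWISTED first-order bound `‖(X A_V − A_U X)w‖ ≤ c₁‖D̃w‖ + c₀‖w‖` ⟹ `‖G_U(Xf) − X(G_Vf)‖ ≤ m_U⁻¹·(c₁·√(m_V⁻¹) + c₀·m_V⁻¹)·‖f‖`.  At the member: `X = χ·`, `c₁, c₀ = O(ε₀R″ + (R″−R′)⁻¹)`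
from `U ≈ V` ON `supp χ` and `[Δ_U, χ]` only — K-, L-, volume-free. [cite: Balaban1985BackgroundPropagators, Thm 3.3 p.399, (3.105) p.414; Balaban1984PropagatorsII, p.238] -/
theorem norm_inv_cutoff_comm_le (AU AV GU GV X : E →ₗ[ℂ] E) (D : E →ₗ[ℂ] F)
    (hGA : ∀ v, GU (AU v) = v) (hUG : ∀ v, AU (GU v) = v) (hAG : ∀ v, AV (GV v) = v)
    {mU mV : ℝ} (hmU : 0 < mU) (hmV : 0 < mV)
    (hcoU : ∀ u : E, mU * ‖u‖ ^ 2 ≤ RCLike.re ⟪u, AU u⟫_ℂ) (hcoV : ∀ u : E, mV * ‖u‖ ^ 2 ≤ RCLike.re ⟪u, AV u⟫_ℂ)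
    (henergy : ∀ w : E, ‖D w‖ ^ 2 ≤ RCLike.re ⟪w, AV w⟫_ℂ)
    {c₁ c₀ : ℝ} (hc₁ : 0 ≤ c₁) (hc₀ : 0 ≤ c₀) (hE : ∀ w : E, ‖X (AV w) - AU (X w)‖ ≤ c₁ * ‖D w‖ + c₀ * ‖w‖) (f : E) :
    ‖GU (X f) - X (GV f)‖ ≤ mU⁻¹ * (c₁ * Real.sqrt mV⁻¹ + c₀ * mV⁻¹) * ‖f‖ := by
  rw [inv_comp_sub_comp_inv_eq AU AV GU GV X hGA hAG f]
  have h1 := norm_le_inv_coercive AU GU hUG hmU hcoU (X (AV (GV f)) - AU (X (GV f)))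
  have h2 := hE (GV f)
  have hw := norm_le_inv_coercive AV GV hAG hmV hcoV f
  have hDw := norm_D_inv_le AV GV D hAG hmV hcoV henergy f
  calc ‖GU (X (AV (GV f)) - AU (X (GV f)))‖ ≤ mU⁻¹ * ‖X (AV (GV f)) - AU (X (GV f))‖ := h1
    _ ≤ mU⁻¹ * (c₁ * ‖D (GV f)‖ + c₀ * ‖GV f‖) := mul_le_mul_of_nonneg_left h2 (inv_nonneg.mpr hmU.le)
    _ ≤ mU⁻¹ * (c₁ * (Real.sqrt mV⁻¹ * ‖f‖) + c₀ * (mV⁻¹ * ‖f‖)) :=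
        mul_le_mul_of_nonneg_left (add_le_add (mul_le_mul_of_nonneg_left hDw hc₁) (mul_le_mul_of_nonneg_left hw hc₀)) (inv_nonneg.mpr hmU.le)
    _ = mU⁻¹ * (c₁ * Real.sqrt mV⁻¹ + c₀ * mV⁻¹) * ‖f‖ := by ring

/-- ★★ **ENERGY EDITION**: with an energy map `D̃_U` for `A_U` as well (`‖D̃_U w‖² ≤ re⟪w, A_U w⟫`),
`‖D̃_U(G_U(Xf) − X(G_Vf))‖ ≤ √(m_U⁻¹)·(c₁·√(m_V⁻¹) + c₀·m_V⁻¹)·‖f‖` — the `𝔥`-currency of the local comparison. [cite: Balaban1985BackgroundPropagators, (3.105) p.414] -/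
theorem norm_D_inv_cutoff_comm_le (AU AV GU GV X : E →ₗ[ℂ] E) (DU : E →ₗ[ℂ] F') (D : E →ₗ[ℂ] F)
    (hGA : ∀ v, GU (AU v) = v) (hUG : ∀ v, AU (GU v) = v) (hAG : ∀ v, AV (GV v) = v)
    {mU mV : ℝ} (hmU : 0 < mU) (hmV : 0 < mV)
    (hcoU : ∀ u : E, mU * ‖u‖ ^ 2 ≤ RCLike.re ⟪u, AU u⟫_ℂ) (hcoV : ∀ u : E, mV * ‖u‖ ^ 2 ≤ RCLike.re ⟪u, AV u⟫_ℂ)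
    (henergyU : ∀ w : E, ‖DU w‖ ^ 2 ≤ RCLike.re ⟪w, AU w⟫_ℂ) (henergy : ∀ w : E, ‖D w‖ ^ 2 ≤ RCLike.re ⟪w, AV w⟫_ℂ)
    {c₁ c₀ : ℝ} (hc₁ : 0 ≤ c₁) (hc₀ : 0 ≤ c₀) (hE : ∀ w : E, ‖X (AV w) - AU (X w)‖ ≤ c₁ * ‖D w‖ + c₀ * ‖w‖) (f : E) :
    ‖DU (GU (X f) - X (GV f))‖ ≤ Real.sqrt mU⁻¹ * (c₁ * Real.sqrt mV⁻¹ + c₀ * mV⁻¹) * ‖f‖ := by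
  rw [inv_comp_sub_comp_inv_eq AU AV GU GV X hGA hAG f]
  have h1 := norm_D_inv_le AU GU DU hUG hmU hcoU henergyU (X (AV (GV f)) - AU (X (GV f)))
  have h2 := hE (GV f)
  have hw := norm_le_inv_coercive AV GV hAG hmV hcoV f
  have hDw := norm_D_inv_le AV GV D hAG hmV hcoV henergy f
  have hs : 0 ≤ Real.sqrt mU⁻¹ := Real.sqrt_nonneg _
  calc ‖DU (GU (X (AV (GV f)) - AU (X (GV f))))‖ ≤ Real.sqrt mU⁻¹ * ‖X (AV (GV f)) - AU (X (GV f))‖ := h1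
    _ ≤ Real.sqrt mU⁻¹ * (c₁ * ‖D (GV f)‖ + c₀ * ‖GV f‖) := mul_le_mul_of_nonneg_left h2 hs
    _ ≤ Real.sqrt mU⁻¹ * (c₁ * (Real.sqrt mV⁻¹ * ‖f‖) + c₀ * (mV⁻¹ * ‖f‖)) :=
        mul_le_mul_of_nonneg_left (add_le_add (mul_le_mul_of_nonneg_left hDw hc₁) (mul_le_mul_of_nonneg_left hw hc₀)) hs
    _ = Real.sqrt mU⁻¹ * (c₁ * Real.sqrt mV⁻¹ + c₀ * mV⁻¹) * ‖f‖ := by ring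

/-! ## §4 The FORM edition (the one second-order differences need)

At a member the difference of two covariant Laplacians with close connections is `Δ_U − Δ_V = D_U*∘(D_U − D_V) + (D_U − D_V)*∘D_V` with `D_U − D_V = η⁻¹(Ad U − Ad V)` BOUNDED
(`O(ε₀R″)` on the cube) — so `(Δ_U − Δ_V)w` is NOT `L²`-small (the `D_U*` outside costs `η⁻¹`), but its PAIRINGS are: `|re⟪z, (Δ_U − Δ_V)w⟫| ≤ c(‖D_Uz‖‖w‖ + ‖z‖‖D_Vw‖)`.  The
comparison therefore runs in the form sense, testing the error equation `A_U e = Y` with `e` itself (Lax–Milgram ∕ Caccioppoli). -/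

/-- the scalar step: `0 ≤ S`, `S ≤ N·√S·(1 + t)`, `0 ≤ N`, `0 ≤ t` ⟹ `√S ≤ N·(1 + t)`. [folklore] -/
theorem sqrt_le_of_sq_le_mul {S N t : ℝ} (hS : 0 ≤ S) (hN : 0 ≤ N) (ht : 0 ≤ t) (h : S ≤ N * Real.sqrt S * (1 + t)) :
    Real.sqrt S ≤ N * (1 + t) := by
  by_cases h0 : Real.sqrt S = 0
  · rw [h0]; positivity
  · have hpos : 0 < Real.sqrt S := lt_of_le_of_ne (Real.sqrt_nonneg _) (Ne.symm h0)
    have h1 : Real.sqrt S * Real.sqrt S ≤ N * (1 + t) * Real.sqrt S := by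
      rw [Real.mul_self_sqrt hS]; linarith
    exact le_of_mul_le_mul_right h1 hpos

/-- ★★★ **THE CUT-OFF RESOLVENT COMPARISON, FORM EDITION**: `A_U` `m_U`-coercive with two-sided inverse `G_U` and energy map `D̃_U` (`‖D̃_Uw‖² ≤ re⟪w, A_Uw⟫`), `A_V` `m_V`-coercive with right
inverse `G_V` and energy map `D̃_V`, and the twisted difference small IN THE FORM SENSE `|re⟪z, (XA_V − A_UX)w⟫| ≤ (c₁‖D̃_Vw‖ + c₀‖w‖)·(‖D̃_Uz‖ + ‖z‖)` ⟹ with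
`N_f := (c₁√(m_V⁻¹) + c₀m_V⁻¹)‖f‖`:  `‖D̃_U(G_U(Xf) − X(G_Vf))‖ ≤ (1 + √(m_U⁻¹))·N_f` and `‖G_U(Xf) − X(G_Vf)‖ ≤ √(m_U⁻¹)(1 + √(m_U⁻¹))·N_f` (test the error equation `A_Ue = Y`
with `e`).  At the member `c₁, c₀ = O(ε₀R″ + (R″−R′)⁻¹)` K-, L-, volume-free. [cite: Balaban1985BackgroundPropagators, Thm 3.3 p.399, (3.100)–(3.105) pp.413–414; Balaban1984PropagatorsII, p.238] -/
theorem norm_inv_cutoff_comm_le_of_form (AU AV GU GV X : E →ₗ[ℂ] E) (DU : E →ₗ[ℂ] F') (D : E →ₗ[ℂ] F)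
    (hUG : ∀ v, AU (GU v) = v) (hAG : ∀ v, AV (GV v) = v) (hGA : ∀ v, GU (AU v) = v)
    {mU mV : ℝ} (hmU : 0 < mU) (hmV : 0 < mV)
    (hcoU : ∀ u : E, mU * ‖u‖ ^ 2 ≤ RCLike.re ⟪u, AU u⟫_ℂ) (hcoV : ∀ u : E, mV * ‖u‖ ^ 2 ≤ RCLike.re ⟪u, AV u⟫_ℂ)
    (henergyU : ∀ w : E, ‖DU w‖ ^ 2 ≤ RCLike.re ⟪w, AU w⟫_ℂ) (henergy : ∀ w : E, ‖D w‖ ^ 2 ≤ RCLike.re ⟪w, AV w⟫_ℂ)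
    {c₁ c₀ : ℝ} (hc₁ : 0 ≤ c₁) (hc₀ : 0 ≤ c₀)
    (hform : ∀ z w : E, |RCLike.re ⟪z, X (AV w) - AU (X w)⟫_ℂ| ≤ (c₁ * ‖D w‖ + c₀ * ‖w‖) * (‖DU z‖ + ‖z‖)) (f : E) :
    ‖DU (GU (X f) - X (GV f))‖ ≤ (1 + Real.sqrt mU⁻¹) * ((c₁ * Real.sqrt mV⁻¹ + c₀ * mV⁻¹) * ‖f‖) ∧
      ‖GU (X f) - X (GV f)‖ ≤ Real.sqrt mU⁻¹ * (1 + Real.sqrt mU⁻¹) * ((c₁ * Real.sqrt mV⁻¹ + c₀ * mV⁻¹) * ‖f‖) := by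
  rw [inv_comp_sub_comp_inv_eq AU AV GU GV X hGA hAG f]
  set w : E := GV f with hw
  set Y : E := X (AV w) - AU (X w) with hY
  set e : E := GU Y with he
  -- size of the source
  have hwn := norm_le_inv_coercive AV GV hAG hmV hcoV f
  have hDw := norm_D_inv_le AV GV D hAG hmV hcoV henergy f
  set N : ℝ := (c₁ * Real.sqrt mV⁻¹ + c₀ * mV⁻¹) * ‖f‖ with hN
  have hN0 : 0 ≤ N := by positivity
  have hNw : c₁ * ‖D w‖ + c₀ * ‖w‖ ≤ N := by
    rw [hN]
    calc c₁ * ‖D w‖ + c₀ * ‖w‖ ≤ c₁ * (Real.sqrt mV⁻¹ * ‖f‖) + c₀ * (mV⁻¹ * ‖f‖) :=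
          add_le_add (mul_le_mul_of_nonneg_left hDw hc₁) (mul_le_mul_of_nonneg_left hwn hc₀)
      _ = (c₁ * Real.sqrt mV⁻¹ + c₀ * mV⁻¹) * ‖f‖ := by ring
  -- the error equation tested with the error
  have hAe : AU e = Y := by rw [he, hUG]
  set S : ℝ := RCLike.re ⟪e, AU e⟫_ℂ with hS
  have hS1 : ‖DU e‖ ^ 2 ≤ S := henergyU e
  have hS2 : mU * ‖e‖ ^ 2 ≤ S := hcoU e
  have hS0 : 0 ≤ S := le_trans (sq_nonneg _) hS1
  have hSle : S ≤ N * (‖DU e‖ + ‖e‖) := by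
    have h1 : S ≤ |RCLike.re ⟪e, X (AV w) - AU (X w)⟫_ℂ| := by rw [hS, hAe]; exact le_abs_self _
    exact h1.trans ((hform e w).trans (mul_le_mul_of_nonneg_right hNw (by positivity)))
  set t : ℝ := Real.sqrt mU⁻¹ with ht
  have ht0 : 0 ≤ t := Real.sqrt_nonneg _
  have hDUe : ‖DU e‖ ≤ Real.sqrt S := Real.le_sqrt_of_sq_le hS1
  have hee : ‖e‖ ≤ t * Real.sqrt S := by
    have h1 : ‖e‖ ^ 2 ≤ (t * Real.sqrt S) ^ 2 := by
      rw [mul_pow, ht, Real.sq_sqrt (inv_nonneg.mpr hmU.le), Real.sq_sqrt hS0, inv_mul_eq_div, le_div_iff₀ hmU, mul_comm]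
      exact hS2
    exact (pow_le_pow_iff_left₀ (norm_nonneg _) (by positivity) two_ne_zero).1 h1
  have hkey : S ≤ N * Real.sqrt S * (1 + t) := by
    calc S ≤ N * (‖DU e‖ + ‖e‖) := hSle
      _ ≤ N * (Real.sqrt S + t * Real.sqrt S) := mul_le_mul_of_nonneg_left (add_le_add hDUe hee) hN0
      _ = N * Real.sqrt S * (1 + t) := by ring
  have hsq := sqrt_le_of_sq_le_mul hS0 hN0 ht0 hkey
  refine ⟨hDUe.trans (by rw [mul_comm]; exact hsq), hee.trans ?_⟩
  calc t * Real.sqrt S ≤ t * (N * (1 + t)) := mul_le_mul_of_nonneg_left hsq ht0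
    _ = t * (1 + t) * N := by ring

end Summit.QuantumFields.YangMills.Theorems.Prop7CutoffResolventComparison

end
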